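import Summits.CriticalPhenomena.PercolationContinuityZ3.Theses.PercNearOneGluing
import Literature.Probability.Percolation.PercolationProofs
import Literature.Probability.Percolation.ConditionalPositiveAssociationProofs
import Literature.Probability.Percolation.TwoClusterConditionalAssociationProofs
import Summits.CriticalPhenomena.PercolationContinuityZ3.Theorems.PercNearOneGluingAdditiveGluingGoodStepResidual
import Summits.CriticalPhenomena.PercolationContinuityZ3.Theorems.PercNearOneGluingAdditiveGluingBlockGoodDelMin
import Summits.CriticalPhenomena.PercolationContinuityZ3.Theorems.PercNearOneGluingAdditiveGluingBlockGoodThreeRelays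
import Summits.CriticalPhenomena.PercolationContinuityZ3.Theorems.PercNearOneGluingAdditiveGluingBlockGrowth

/-! # Crux `PercNearOneGluing.AdditiveGluing` (stmt-CriticalPhenomena-4576), residual kernel — the structure class
# `residualKernel_two_A4` (TTRL variant V13176: `S.card = 2`, `A.card = 4`) reduced to its CORE

TTRL deep seat `ttrlatt-v13176-d0`; lands `--supports stmt-CriticalPhenomena-4576`; no definitions, no named facts, no `sorry`.

`residualKernel_two_A4_var13176_of_core`: the variant V13176 (the residual block kernel `hres` of `goodStep_of_residualKernel` at
`S.card = 2`, `A.card = 4`) follows from its CORE — the same kernel with, in addition: the four relays `b, a₀, a₂, a₃` named and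
pairwise distinct; the gluing-drift witness placed at `a₃`; DELETION DRIFT OR A BAD POSITIVE NEIGHBOUR (a vertex `z ∉ S` which is
one of `a₂, a₃`, or a non-relay joined to the block by a positive pair, and is strictly less reliable than `a₀` in the DELETED
graph `u − S`); and a DOUBLE HIT of positive probability (`K_S ∌ a₀`, `K_S ∋ a₂, a₃`, `a₂ ↔ b`, `a₃ ↔ b`).  The complement of the
core is covered by landed standalone leaves: `a₀ = b` / drift witness in `{a₀, b}` are vacuous (gluing only raises two-point
functions, `blockGrowth_glue_real_openConn`; `μ(x ↔ x) = 1`); `a₀` minimal in `u − S` with reliable block neighbours is the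
deletion-minimiser leaf `blockGood_leaf_delMin` (Kozma–Nitzan Thm 4 at the glued block); a null double hit is
`blockGood_threeRelays_doubleHit`.  At `n = 6` (`V = A ⊔ S`) the core is exactly the deletion-drift sliver
`argmin_A μ_{u−S}(· ↔ b) ∉ {a₀}` with a possible double hit.
[cite: KozmaNitzan2024, §3.2 (Definition p. 12, Thm 4 p. 12, Lemma 5 p. 13), Question 7 (p. 36)]
-/

namespace Summit.CriticalPhenomena.PercolationContinuityZ3.Theorems

open MeasureTheory Literature.Probability.LatticeModels Literature.Probability.Percolation
open scoped Classical BigOperators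


/-- **V13176 from its core.**  The variant `residualKernel_two_A4` (TTRL V13176 of the residual kernel of
`goodStep_of_residualKernel`) follows from its core (the hypothesis `hcore`, see the module docstring): the case
`a₀ = b` and drift witnesses in `{a₀, b}` are vacuous (gluing only raises two-point functions, `μ(x ↔ x) = 1`); if `a₀`
minimises the deleted two-point function `μ_{u−S}(· ↔ b)` over `A` and every positive outside neighbour of the block is at
least as `u−S`-reliable, the landed leaf `blockGood_leaf_delMin` closes it; if the double hit is null, the landed
`blockGood_threeRelays_doubleHit` closes it. [cite: KozmaNitzan2024, §3.2 (Thm 4 p. 12, Lemma 5 p. 13), Question 7 (p. 36)] -/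
theorem residualKernel_two_A4_var13176_of_core
    (hcore : ∀ (n : ℕ) (u : Sym2 (Fin n) → unitInterval) (A S : Finset (Fin n))
      (b a₀ a₂ a₃ z : Fin n) (sel : Finset (Fin n) → Fin n),
      b ∈ A → a₀ ∈ A → a₂ ∈ A → a₃ ∈ A → a₀ ≠ b → a₂ ≠ b → a₃ ≠ b → a₂ ≠ a₀ → a₃ ≠ a₀ → a₂ ≠ a₃ →
      (∀ a ∈ A, a = a₀ ∨ a = a₂ ∨ a = a₃ ∨ a = b) → Disjoint S A → S.card = 2 → A.card = 4 →
      (∀ W, sel W ∈ A) →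
      (∀ a ∈ A, (prodBernoulli u).real (openConn a₀ b) ≤ (prodBernoulli u).real (openConn a b)) →
      (∀ v ∈ S, (prodBernoulli u).real (openConn v b) < (prodBernoulli u).real (openConn a₀ b)) →
      ((prodBernoulli (fun e : Sym2 (Fin n) => if (∀ x ∈ e, x ∈ S) ∧ ¬ e.IsDiag then 1 else u e)).real (openConn a₃ b) <
        (prodBernoulli (fun e : Sym2 (Fin n) => if (∀ x ∈ e, x ∈ S) ∧ ¬ e.IsDiag then 1 else u e)).real (openConn a₀ b)) →
      z ∉ S → (z = a₂ ∨ z = a₃ ∨ (z ∉ A ∧ ∃ s ∈ S, (u s(s, z) : ℝ) ≠ 0)) →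
      ((prodBernoulli (fun e : Sym2 (Fin n) => if ∃ y ∈ S, y ∈ e then (0 : unitInterval) else u e)).real (openConn z b) <
        (prodBernoulli (fun e : Sym2 (Fin n) => if ∃ y ∈ S, y ∈ e then (0 : unitInterval) else u e)).real (openConn a₀ b)) →
      (0 < (prodBernoulli u).real
        ((⋃ s ∈ S, openConn s a₀)ᶜ ∩ (⋃ s ∈ S, openConn s a₂) ∩ (⋃ s ∈ S, openConn s a₃)
          ∩ openConn a₂ b ∩ openConn a₃ b)) →
      (prodBernoulli u).real (openConn a₀ b)
          + (prodBernoulli u).real ((openConn a₀ b)ᶜ ∩ (⋃ s ∈ S, openConn a₀ s) ∩ (⋃ s ∈ S, openConn s b))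
        ≤ (prodBernoulli u).real (⋃ s ∈ S, openConn s b)
          + ∑ W ∈ (Finset.univ : Finset (Finset (Fin n))).filter (fun W => Disjoint W A),
              (prodBernoulli u).real {ω : BondConfig (Fin n) | ∀ z : Fin n, (z ∈ W ↔ ω ∈ ⋃ s ∈ S, openConn s z)}
                * (prodBernoulli u).real (openConnIn ((W : Set (Fin n))ᶜ) (sel W) b)) :
    ∀ (n : ℕ) (u : Sym2 (Fin n) → unitInterval) (A S : Finset (Fin n)) (b a₀ : Fin n) (sel : Finset (Fin n) → Fin n), b ∈ A → Disjoint S A → S.card = 2 → A.card = 4 → (∀ W, sel W ∈ A) → a₀ ∈ A → (∀ a ∈ A, (prodBernoulli u).real (openConn a₀ b) ≤ (prodBernoulli u).real (openConn a b)) → (∀ v ∈ S, (prodBernoulli u).real (openConn v b) < (prodBernoulli u).real (openConn a₀ b)) → (∃ a ∈ A, (prodBernoulli (fun e : Sym2 (Fin n) => if (∀ x ∈ e, x ∈ S) ∧ ¬ e.IsDiag then 1 else u e)).real (openConn a b) < (prodBernoulli (fun e : Sym2 (Fin n) => if (∀ x ∈ e, x ∈ S) ∧ ¬ e.IsDiag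 then 1 else u e)).real (openConn a₀ b)) → (prodBernoulli u).real (openConn a₀ b) + (prodBernoulli u).real ((openConn a₀ b)ᶜ ∩ (⋃ s ∈ S, openConn a₀ s) ∩ (⋃ s ∈ S, openConn s b)) ≤ (prodBernoulli u).real (⋃ s ∈ S, openConn s b) + ∑ W ∈ (Finset.univ : Finset (Finset (Fin n))).filter (fun W => Disjoint W A), (prodBernoulli u).real {ω : BondConfig (Fin n) | ∀ z : Fin n, (z ∈ W ↔ ω ∈ ⋃ s ∈ S, openConn s z)} * (prodBernoulli u).real (openConnIn ((W : Set (Fin n))ᶜ) (sel W) b) := by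
  intro n u A S b a₀ sel hb hSA hS2 hA4 hsel ha₀ hmin hbad hdrift
  obtain ⟨a₁, ha₁, hlt⟩ := hdrift
  -- `μ_w(x ↔ x) = 1`
  have hself : ∀ (w : Sym2 (Fin n) → unitInterval) (x : Fin n),
      (prodBernoulli w).real (openConn x x) = 1 := by
    intro w x
    have hx : openConn x x = (Set.univ : Set (BondConfig (Fin n))) :=
      Set.eq_univ_of_forall fun ω => SimpleGraph.Reachable.refl _
    rw [hx]
    exact probReal_univ
  -- gluing only raises two-point functions
  have hge : ∀ x y : Fin n, (prodBernoulli u).real (openConn x y) ≤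
      (prodBernoulli (fun e : Sym2 (Fin n) => if (∀ x ∈ e, x ∈ S) ∧ ¬ e.IsDiag then 1 else u e)).real
        (openConn x y) := by
    intro x y
    rw [blockGrowth_glue_real_openConn]
    exact le_add_of_nonneg_right measureReal_nonneg
  have ha₁a₀ : a₁ ≠ a₀ := by
    rintro rfl
    exact lt_irrefl _ hlt
  have ha₁b : a₁ ≠ b := by
    intro h
    rw [h, hself] at hlt
    have h1 : (prodBernoulli (fun e : Sym2 (Fin n) => if (∀ x ∈ e, x ∈ S) ∧ ¬ e.IsDiag then 1 else u e)).real
        (openConn a₀ b) ≤ 1 := measureReal_le_one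
    linarith
  have ha₀b : a₀ ≠ b := by
    intro h
    rw [h] at hlt hmin
    have h1 := hmin a₁ ha₁
    rw [hself] at h1
    have h2 := hge a₁ b
    have h3 : (prodBernoulli (fun e : Sym2 (Fin n) => if (∀ x ∈ e, x ∈ S) ∧ ¬ e.IsDiag then 1 else u e)).real
        (openConn b b) ≤ 1 := measureReal_le_one
    linarith
  -- the two relays other than `a₀, b`
  have hcard2 : ((A.erase b).erase a₀).card = 2 := by
    rw [Finset.card_erase_of_mem (Finset.mem_erase.mpr ⟨ha₀b, ha₀⟩), Finset.card_erase_of_mem hb, hA4]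
  obtain ⟨a₂, a₃, h23, hA23⟩ := Finset.card_eq_two.mp hcard2
  have ha₂' : a₂ ∈ (A.erase b).erase a₀ := by rw [hA23]; exact Finset.mem_insert_self _ _
  have ha₃' : a₃ ∈ (A.erase b).erase a₀ := by
    rw [hA23]; exact Finset.mem_insert_of_mem (Finset.mem_singleton_self _)
  simp only [Finset.mem_erase] at ha₂' ha₃'
  obtain ⟨ha₂a₀, ha₂b, ha₂⟩ := ha₂'
  obtain ⟨ha₃a₀, ha₃b, ha₃⟩ := ha₃'
  have hAenum : ∀ a ∈ A, a = a₀ ∨ a = a₂ ∨ a = a₃ ∨ a = b := by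
    intro a ha
    by_cases hab : a = b
    · exact Or.inr (Or.inr (Or.inr hab))
    by_cases haa : a = a₀
    · exact Or.inl haa
    have hmem : a ∈ (A.erase b).erase a₀ := Finset.mem_erase.mpr ⟨haa, Finset.mem_erase.mpr ⟨hab, ha⟩⟩
    rw [hA23, Finset.mem_insert, Finset.mem_singleton] at hmem
    rcases hmem with h | h
    · exact Or.inr (Or.inl h)
    · exact Or.inr (Or.inr (Or.inl h))
  have hAenum' : ∀ a ∈ A, a = a₀ ∨ a = a₃ ∨ a = a₂ ∨ a = b := by
    intro a ha
    rcases hAenum a ha with h | h | h | h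
    · exact Or.inl h
    · exact Or.inr (Or.inr (Or.inl h))
    · exact Or.inr (Or.inl h)
    · exact Or.inr (Or.inr (Or.inr h))
  -- leaf 1: the deletion-minimiser leaf (KN Thm 4 at the glued block)
  by_cases hdel :
      (∀ a ∈ A,
        (prodBernoulli (fun e : Sym2 (Fin n) => if ∃ y ∈ S, y ∈ e then (0 : unitInterval) else u e)).real
            (openConn a₀ b) ≤
          (prodBernoulli (fun e : Sym2 (Fin n) => if ∃ y ∈ S, y ∈ e then (0 : unitInterval) else u e)).real
            (openConn a b)) ∧
      (∀ s ∈ S, ∀ z : Fin n, z ∉ S → (u s(s, z) : ℝ) ≠ 0 →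
        (prodBernoulli (fun e : Sym2 (Fin n) => if ∃ y ∈ S, y ∈ e then (0 : unitInterval) else u e)).real
            (openConn a₀ b) ≤
          (prodBernoulli (fun e : Sym2 (Fin n) => if ∃ y ∈ S, y ∈ e then (0 : unitInterval) else u e)).real
            (openConn z b))
  · exact blockGood_leaf_delMin u A S b a₀ sel hb ha₀ hSA hsel hdel.1 hdel.2
  -- the bad vertex `z` of the deleted graph
  have hz : ∃ z : Fin n, z ∉ S ∧ (z ∈ A ∨ ∃ s ∈ S, (u s(s, z) : ℝ) ≠ 0) ∧
      (prodBernoulli (fun e : Sym2 (Fin n) => if ∃ y ∈ S, y ∈ e then (0 : unitInterval) else u e)).real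
          (openConn z b) <
        (prodBernoulli (fun e : Sym2 (Fin n) => if ∃ y ∈ S, y ∈ e then (0 : unitInterval) else u e)).real
          (openConn a₀ b) := by
    rw [not_and_or] at hdel
    rcases hdel with h | h
    · push Not at h
      obtain ⟨a, ha, hlt'⟩ := h
      exact ⟨a, Finset.disjoint_right.mp hSA ha, Or.inl ha, hlt'⟩
    · push Not at h
      obtain ⟨s, hs, z, hzS, hne, hlt'⟩ := h
      exact ⟨z, hzS, Or.inr ⟨s, hs, hne⟩, hlt'⟩
  obtain ⟨z, hzS, hzA0, hzlt⟩ := hz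
  -- a bad vertex inside `A` is one of the two other relays
  have hzrel : z ∈ A → z = a₂ ∨ z = a₃ := by
    intro hzAm
    rcases hAenum z hzAm with h | h | h | h
    · rw [h] at hzlt
      exact absurd hzlt (lt_irrefl _)
    · exact Or.inl h
    · exact Or.inr h
    · rw [h, hself] at hzlt
      have h1 : (prodBernoulli (fun e : Sym2 (Fin n) => if ∃ y ∈ S, y ∈ e then (0 : unitInterval) else u e)).real
          (openConn a₀ b) ≤ 1 := measureReal_le_one
      exact absurd hzlt (not_lt.mpr h1)
  have hzA : z = a₂ ∨ z = a₃ ∨ (z ∉ A ∧ ∃ s ∈ S, (u s(s, z) : ℝ) ≠ 0) := by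
    rcases hzA0 with h | h
    · rcases hzrel h with h' | h'
      · exact Or.inl h'
      · exact Or.inr (Or.inl h')
    · by_cases hzAm : z ∈ A
      · rcases hzrel hzAm with h' | h'
        · exact Or.inl h'
        · exact Or.inr (Or.inl h')
      · exact Or.inr (Or.inr ⟨hzAm, h⟩)
  have hzA' : z = a₃ ∨ z = a₂ ∨ (z ∉ A ∧ ∃ s ∈ S, (u s(s, z) : ℝ) ≠ 0) := by
    rcases hzA with h | h | h
    · exact Or.inr (Or.inl h)
    · exact Or.inl h
    · exact Or.inr (Or.inr h)
  have hSne : S.Nonempty := Finset.card_pos.mp (by omega)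
  -- leaf 2: no double hit
  by_cases hDbl : (prodBernoulli u).real
      ((⋃ s ∈ S, openConn s a₀)ᶜ ∩ (⋃ s ∈ S, openConn s a₂) ∩ (⋃ s ∈ S, openConn s a₃)
        ∩ openConn a₂ b ∩ openConn a₃ b) = 0
  · have h := blockGood_threeRelays_doubleHit u A S b a₀ a₂ a₃ sel hb ha₀ ha₂ ha₃ hAenum hSne hsel hmin
    rw [hDbl, add_zero] at h
    exact h
  have hDblpos : 0 < (prodBernoulli u).real
      ((⋃ s ∈ S, openConn s a₀)ᶜ ∩ (⋃ s ∈ S, openConn s a₂) ∩ (⋃ s ∈ S, openConn s a₃)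
        ∩ openConn a₂ b ∩ openConn a₃ b) := lt_of_le_of_ne measureReal_nonneg (Ne.symm hDbl)
  have hDblset : ((⋃ s ∈ S, openConn s a₀)ᶜ ∩ (⋃ s ∈ S, openConn s a₃) ∩ (⋃ s ∈ S, openConn s a₂)
        ∩ openConn a₃ b ∩ openConn a₂ b : Set (BondConfig (Fin n))) =
      (⋃ s ∈ S, openConn s a₀)ᶜ ∩ (⋃ s ∈ S, openConn s a₂) ∩ (⋃ s ∈ S, openConn s a₃)
        ∩ openConn a₂ b ∩ openConn a₃ b := by
    ext ω
    simp only [Set.mem_inter_iff]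
    constructor
    · rintro ⟨⟨⟨⟨h1, h2⟩, h3⟩, h4⟩, h5⟩
      exact ⟨⟨⟨⟨h1, h3⟩, h2⟩, h5⟩, h4⟩
    · rintro ⟨⟨⟨⟨h1, h2⟩, h3⟩, h4⟩, h5⟩
      exact ⟨⟨⟨⟨h1, h3⟩, h2⟩, h5⟩, h4⟩
  have hDblpos' : 0 < (prodBernoulli u).real
      ((⋃ s ∈ S, openConn s a₀)ᶜ ∩ (⋃ s ∈ S, openConn s a₃) ∩ (⋃ s ∈ S, openConn s a₂)
        ∩ openConn a₃ b ∩ openConn a₂ b) := by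
    rw [hDblset]; exact hDblpos
  -- the drift witness is one of the two other relays
  rcases hAenum a₁ ha₁ with h | h | h | h
  · exact absurd h ha₁a₀
  · subst h
    have key := hcore n u A S b a₀ a₃ a₁ z sel hb ha₀ ha₃ ha₂ ha₀b ha₃b ha₂b ha₃a₀ ha₂a₀ (Ne.symm h23) hAenum'
      hSA hS2 hA4 hsel hmin hbad hlt hzS hzA' hzlt hDblpos'
    exact key
  · subst h
    have key := hcore n u A S b a₀ a₂ a₁ z sel hb ha₀ ha₂ ha₃ ha₀b ha₂b ha₃b ha₂a₀ ha₃a₀ h23 hAenum hSA hS2 hA4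
      hsel hmin hbad hlt hzS hzA hzlt hDblpos
    exact key
  · exact absurd h ha₁b

/-- Registered helper stub `stub_residualKernelTwoA4OfCore_v13176` (TTRL deep seat `ttrlatt-v13176-d0`): the variant V13176
(`residualKernel_two_A4`) from its core (= `residualKernel_two_A4_var13176_of_core`).
[cite: KozmaNitzan2024, §3.2 (Thm 4 p. 12, Lemma 5 p. 13), Question 7 (p. 36)] -/
theorem stub_residualKernelTwoA4OfCore_v13176 : (∀ (n : ℕ) (u : Sym2 (Fin n) → unitInterval) (A S : Finset (Fin n)) (b a₀ a₂ a₃ z : Fin n) (sel : Finset (Fin n) → Fin n), b ∈ A → a₀ ∈ A → a₂ ∈ A → a₃ ∈ A → a₀ ≠ b → a₂ ≠ b → a₃ ≠ b → a₂ ≠ a₀ → a₃ ≠ a₀ → a₂ ≠ a₃ → (∀ a ∈ A, a = a₀ ∨ a = a₂ ∨ a = a₃ ∨ a = b) → Disjoint S A → S.card = 2 → A.card = 4 → (∀ W, sel W ∈ A) → (∀ a ∈ A, (prodBernoulli u).real (openConn a₀ b) ≤ (prodBernoulli u).real (openConn a b)) → (∀ v ∈ S, (prodBernoulli u).real (openConn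 v b) < (prodBernoulli u).real (openConn a₀ b)) → ((prodBernoulli (fun e : Sym2 (Fin n) => if (∀ x ∈ e, x ∈ S) ∧ ¬ e.IsDiag then 1 else u e)).real (openConn a₃ b) < (prodBernoulli (fun e : Sym2 (Fin n) => if (∀ x ∈ e, x ∈ S) ∧ ¬ e.IsDiag then 1 else u e)).real (openConn a₀ b)) → z ∉ S → (z = a₂ ∨ z = a₃ ∨ (z ∉ A ∧ ∃ s ∈ S, (u s(s, z) : ℝ) ≠ 0)) → ((prodBernoulli (fun e : Sym2 (Fin n) => if ∃ y ∈ S, y ∈ e then (0 : unitInterval) else u e)).real (openConn z b) < (prodBernoulli (fun e : Sym2 (Fin n) => if ∃ y ∈ S, y ∈ e then (0 : unitInterval) else u e)).real (openConn a₀ b)) → (0 < (prodBernoulli u).real ((⋃ s ∈ S, openConn s a₀)ᶜ ∩ (⋃ s ∈ S, openConn s a₂) ∩ (⋃ s ∈ S, openConn s a₃) ∩ openConn a₂ b ∩ openConn a₃ b)) → (prodBernoulli u).real (openConn a₀ b) + (prodBernoulli u).real ((openConn a₀ b)ᶜ ∩ (⋃ s ∈ S, openConn a₀ s) ∩ (⋃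 s ∈ S, openConn s b)) ≤ (prodBernoulli u).real (⋃ s ∈ S, openConn s b) + ∑ W ∈ (Finset.univ : Finset (Finset (Fin n))).filter (fun W => Disjoint W A), (prodBernoulli u).real {ω : BondConfig (Fin n) | ∀ z : Fin n, (z ∈ W ↔ ω ∈ ⋃ s ∈ S, openConn s z)} * (prodBernoulli u).real (openConnIn ((W : Set (Fin n))ᶜ) (sel W) b)) → ∀ (n : ℕ) (u : Sym2 (Fin n) → unitInterval) (A S : Finset (Fin n)) (b a₀ : Fin n) (sel : Finset (Fin n) → Fin n), b ∈ A → Disjoint S A → S.card = 2 → A.card = 4 → (∀ W, sel W ∈ A) → a₀ ∈ A → (∀ a ∈ A, (prodBernoulli u).real (openConn a₀ b) ≤ (prodBernoulli u).real (openConn a b)) → (∀ v ∈ S, (prodBernoulli u).real (openConn v b) < (prodBernoulli u).real (openConn a₀ b)) → (∃ a ∈ A, (prodBernoulli (fun e : Sym2 (Fin n) => if (∀ x ∈ e, x ∈ S) ∧ ¬ e.IsDiag then 1 else u e)).real (openConn a b) < (prodBernoulli (fun e : Sym2 (Fin n) => if (∀ x ∈ e, x ∈ S) ∧ ¬ e.IsDiag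 then 1 else u e)).real (openConn a₀ b)) → (prodBernoulli u).real (openConn a₀ b) + (prodBernoulli u).real ((openConn a₀ b)ᶜ ∩ (⋃ s ∈ S, openConn a₀ s) ∩ (⋃ s ∈ S, openConn s b)) ≤ (prodBernoulli u).real (⋃ s ∈ S, openConn s b) + ∑ W ∈ (Finset.univ : Finset (Finset (Fin n))).filter (fun W => Disjoint W A), (prodBernoulli u).real {ω : BondConfig (Fin n) | ∀ z : Fin n, (z ∈ W ↔ ω ∈ ⋃ s ∈ S, openConn s z)} * (prodBernoulli u).real (openConnIn ((W : Set (Fin n))ᶜ) (sel W) b) :=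
  residualKernel_two_A4_var13176_of_core

end Summit.CriticalPhenomena.PercolationContinuityZ3.Theorems
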